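import Mathlib
import Summits.ValiantsHypothesis.ValiantsHypothesis.Theorems.ProofCarryingSymmetryStabilityIff
import Summits.ValiantsHypothesis.ValiantsHypothesis.Theorems.ProofCarryingSymmetryRestorationQPVpFamilyPiCircuit

/-!
# Route ProofCarryingSymmetry, crux `RestorationQP` — the stability bet is implied by UNIFORM restoration

Lead c3 (line `registered`).  The line's registered bet S2⁗ (`stub_proofsToDistEquiv`: size-`t` `P_c(ℂ)`
proofs of all invariance identities `C ∘ σ = C` ⇒ a circuit `C'` for `Ĉ` of size polynomial in
`|C| + t + n` whose renamed unfoldings are inter-derivable in `P_f(ℂ)` without distributivity) and the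
route's stability statement L (item stmt-ValiantsHypothesis-10358; L ⟺ S2⁗ is
`stabilityOfProvableSymmetry_iff_proofsToDistEquiv`) are both CONSEQUENCES of UNIFORM POLYNOMIAL SYMMETRY
RESTORATION — one exponent `c` such that every straight-line circuit `C` over `ℂ` computing a diagonally
`S_n`-invariant polynomial has an `S_n`-symmetric labelled circuit of size `≤ (|C| + n + 2)^c` — simply
because provable identities are identities (soundness of `P_c`), so the proofs may be forgotten.  The same
hypothesis implies the crux `RestorationQP` outright (through W1, `stub_vpFamily_piCircuit`).

Consequently (with `RestorationQP → T′`, `invarianceProvableQP'_of_restorationQP`, cycle 2): BOTH open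
stubs of the line and the crux itself are sandwiched between uniform polynomial restoration (above) and
quasi-polynomial restoration (below, `T′ ∧ S2⁗ → RestorationQP`); in particular a refutation of the bet
(`not_uniformRestoration_of_not_proofsToDistEquiv`) must exhibit, for every exponent `c`, a circuit
computing an invariant polynomial whose symmetric complexity exceeds `(|C| + n + 2)^c` — an "arithmetic
Cai–Fürer–Immerman family", whose existence is open (Dwivedi–Pago–Seppelt 2026, Outlook Q3).
Everything here is proved; no named facts.
-/

-- single-problem summit: `Summit.ValiantsHypothesis.ValiantsHypothesis.…` is the namespace by design (D-0017)
set_option linter.dupNamespace false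

namespace Summit.ValiantsHypothesis.ValiantsHypothesis.Theorems

open Literature.Computability.AlgebraicComplexity

/-- **Uniform polynomial restoration ⇒ L.**  If one exponent `c` restores symmetry for every
straight-line circuit computing a diagonally invariant polynomial at cost `(|C| + n + 2)^c`, then the
route's stability statement L holds with the same exponent: the hypothesis of L (proofs of all
`C ∘ σ = C`) gives invariance of `Ĉ` by soundness of `P_c` (`HasPCProofOfSize.eval_eq`), and
`(|C| + n + 2)^c ≤ (|C| + t + n + 2)^c`. [folklore: HrubesTzameret2015 Prop. 1.1 (soundness)] -/
theorem stabilityOfProvableSymmetry_of_uniformRestoration :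
    (∃ c : ℕ, ∀ (n : ℕ) (C : PICircuit ℂ (Fin n × Fin n)),
      (∀ σ : Equiv.Perm (Fin n),
        MvPolynomial.rename (fun x : Fin n × Fin n => σ • x) C.eval = C.eval) →
      ∃ (G : Type) (_ : Fintype G) (D : LabelledArithCircuit ℂ (Fin n × Fin n) Unit G),
        D.IsSymmetric (Equiv.Perm (Fin n)) ∧ D.eval (D.output ()) = C.eval ∧
        Fintype.card G ≤ (C.size + n + 2) ^ c) →
    ∃ c : ℕ, ∀ (n t : ℕ) (C : PICircuit ℂ (Fin n × Fin n)),
      (∀ σ : Equiv.Perm (Fin n),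
        HasPCProofOfSize (C.rename fun x : Fin n × Fin n => σ • x) C t) →
      ∃ (G : Type) (_ : Fintype G) (D : LabelledArithCircuit ℂ (Fin n × Fin n) Unit G),
        D.IsSymmetric (Equiv.Perm (Fin n)) ∧ D.eval (D.output ()) = C.eval ∧
        Fintype.card G ≤ (C.size + t + n + 2) ^ c := by
  rintro ⟨c, hc⟩
  refine ⟨c, fun n t C hC => ?_⟩
  have hinv : ∀ σ : Equiv.Perm (Fin n),
      MvPolynomial.rename (fun x : Fin n × Fin n => σ • x) C.eval = C.eval := fun σ => by
    rw [← PICircuit.eval_rename]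
    exact (hC σ).eval_eq
  obtain ⟨G, hG, D, hDsym, hDeval, hDcard⟩ := hc n C hinv
  exact ⟨G, hG, D, hDsym, hDeval, hDcard.trans (Nat.pow_le_pow_left (by omega) _)⟩

/-- **Uniform polynomial restoration ⇒ S2⁗ (the line's registered bet `stub_proofsToDistEquiv`).**
Through L (`stabilityOfProvableSymmetry_of_uniformRestoration`) and L ⟺ S2⁗
(`stabilityOfProvableSymmetry_iff_proofsToDistEquiv`: lay the symmetric circuit out as a straight-line
circuit whose renamed unfoldings are AC-equivalent, B-core″). [folklore] -/
theorem proofsToDistEquiv_of_uniformRestoration :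
    (∃ c : ℕ, ∀ (n : ℕ) (C : PICircuit ℂ (Fin n × Fin n)),
      (∀ σ : Equiv.Perm (Fin n),
        MvPolynomial.rename (fun x : Fin n × Fin n => σ • x) C.eval = C.eval) →
      ∃ (G : Type) (_ : Fintype G) (D : LabelledArithCircuit ℂ (Fin n × Fin n) Unit G),
        D.IsSymmetric (Equiv.Perm (Fin n)) ∧ D.eval (D.output ()) = C.eval ∧
        Fintype.card G ≤ (C.size + n + 2) ^ c) →
    ∃ c : ℕ, ∀ (n t : ℕ) (C : PICircuit ℂ (Fin n × Fin n)),
      (∀ σ : Equiv.Perm (Fin n),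
        HasPCProofOfSize (C.rename fun x : Fin n × Fin n => σ • x) C t) →
      ∃ C' : PICircuit ℂ (Fin n × Fin n), C'.eval = C.eval ∧
        C'.size ≤ (C.size + t + n + 2) ^ c ∧
        ∀ σ : Equiv.Perm (Fin n),
          (pfSystem ℂ (Fin n × Fin n)).Provable (C'.rename fun x : Fin n × Fin n => σ • x).unfold
            C'.unfold ⊤ (fun s => if s = PIAxiom.A6 then 0 else ⊤) :=
  fun hU => stabilityOfProvableSymmetry_iff_proofsToDistEquiv.mp
    (stabilityOfProvableSymmetry_of_uniformRestoration hU)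

/-- **What a refutation of the bet must deliver** (contrapositive, for the crux's disprover): if S2⁗
fails then uniform polynomial restoration fails, i.e. for EVERY exponent `c` there is a straight-line
circuit `C` over `ℂ` computing a diagonally `S_n`-invariant polynomial none of whose `S_n`-symmetric
labelled circuits has at most `(|C| + n + 2)^c` gates — a family with a super-polynomial gap between
symmetric and plain circuit complexity (an "arithmetic CFI" family; open, Dwivedi–Pago–Seppelt 2026
Outlook Q3). [folklore] -/
theorem not_uniformRestoration_of_not_proofsToDistEquiv
    (hS : ¬ ∃ c : ℕ, ∀ (n t : ℕ) (C : PICircuit ℂ (Fin n × Fin n)),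
      (∀ σ : Equiv.Perm (Fin n),
        HasPCProofOfSize (C.rename fun x : Fin n × Fin n => σ • x) C t) →
      ∃ C' : PICircuit ℂ (Fin n × Fin n), C'.eval = C.eval ∧
        C'.size ≤ (C.size + t + n + 2) ^ c ∧
        ∀ σ : Equiv.Perm (Fin n),
          (pfSystem ℂ (Fin n × Fin n)).Provable (C'.rename fun x : Fin n × Fin n => σ • x).unfold
            C'.unfold ⊤ (fun s => if s = PIAxiom.A6 then 0 else ⊤)) :
    ∀ c : ℕ, ∃ (n : ℕ) (C : PICircuit ℂ (Fin n × Fin n)),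
      (∀ σ : Equiv.Perm (Fin n),
        MvPolynomial.rename (fun x : Fin n × Fin n => σ • x) C.eval = C.eval) ∧
      ∀ (G : Type) (_ : Fintype G) (D : LabelledArithCircuit ℂ (Fin n × Fin n) Unit G),
        D.IsSymmetric (Equiv.Perm (Fin n)) → D.eval (D.output ()) = C.eval →
        (C.size + n + 2) ^ c < Fintype.card G := by
  intro c
  by_contra h
  refine hS (proofsToDistEquiv_of_uniformRestoration ⟨c, fun n C hinv => ?_⟩)
  by_contra h'
  exact h ⟨n, C, hinv, fun G hG D hsym hev => not_le.mp fun hle => h' ⟨G, hG, D, hsym, hev, hle⟩⟩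

/-- **Uniform polynomial restoration ⇒ the crux `RestorationQP`** (it is a strengthening of the crux:
a VP family has polynomial-size straight-line circuits, W1 `stub_vpFamily_piCircuit`, and
`(n+2)^{c₁} + n + 2)^{c} ≤ 2^{(log₂ n + c')^{c'}}`).  With `RestorationQP → T′`
(`invarianceProvableQP'_of_restorationQP`) and the two theorems above, every statement of line
`registered` — both open stubs and the crux — lies between uniform polynomial restoration and
quasi-polynomial restoration. [folklore] -/
theorem restorationQP_of_uniformRestoration :
    (∃ c : ℕ, ∀ (n : ℕ) (C : PICircuit ℂ (Fin n × Fin n)),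
      (∀ σ : Equiv.Perm (Fin n),
        MvPolynomial.rename (fun x : Fin n × Fin n => σ • x) C.eval = C.eval) →
      ∃ (G : Type) (_ : Fintype G) (D : LabelledArithCircuit ℂ (Fin n × Fin n) Unit G),
        D.IsSymmetric (Equiv.Perm (Fin n)) ∧ D.eval (D.output ()) = C.eval ∧
        Fintype.card G ≤ (C.size + n + 2) ^ c) →
    Summit.ValiantsHypothesis.ValiantsHypothesis.Theses.ProofCarryingSymmetry.RestorationQP := by
  unfold Summit.ValiantsHypothesis.ValiantsHypothesis.Theses.ProofCarryingSymmetry.RestorationQP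
  rintro ⟨c, hc⟩ f hinv hVP
  obtain ⟨c₁, hc₁⟩ := stub_vpFamily_piCircuit f hVP
  -- exponent bookkeeping: `((n+2)^{c₁} + n + 2)^c ≤ 2^((log₂ n + c')^c')`
  refine ⟨c₁ * c + 2 * c + 2, fun n => ?_⟩
  obtain ⟨-, C, hCeval, hCsize⟩ := hc₁ n
  have hinvC : ∀ σ : Equiv.Perm (Fin n),
      MvPolynomial.rename (fun x : Fin n × Fin n => σ • x) C.eval = C.eval := fun σ => by
    rw [hCeval]; exact hinv n σ
  obtain ⟨G, hG, D, hDsym, hDeval, hDcard⟩ := hc n C hinvC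
  refine ⟨G, hG, D, hDsym, hDeval.trans hCeval, hDcard.trans ?_⟩
  -- `(|C| + n + 2)^c ≤ ((n+2)^{c₁+2})^c ≤ (2^{log₂ n + 2})^{(c₁+2)c} ≤ 2^((log₂ n + c')^c')`
  have hn2 : 2 ≤ n + 2 := by omega
  have h1 : C.size + n + 2 ≤ (n + 2) ^ (c₁ + 2) := by
    have hA : 0 < (n + 2) ^ c₁ := Nat.pos_of_ne_zero (pow_ne_zero _ (by omega))
    calc C.size + n + 2 ≤ (n + 2) ^ c₁ + (n + 2) := by omega
      _ ≤ (n + 2) ^ c₁ * (n + 2) + (n + 2) ^ c₁ * (n + 2) :=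
          Nat.add_le_add (Nat.le_mul_of_pos_right _ (by omega)) (Nat.le_mul_of_pos_left _ hA)
      _ = 2 * ((n + 2) ^ c₁ * (n + 2)) := by ring
      _ ≤ (n + 2) * ((n + 2) ^ c₁ * (n + 2)) := Nat.mul_le_mul_right _ hn2
      _ = (n + 2) ^ (c₁ + 2) := by ring
  have hlog : n + 2 ≤ 2 ^ (Nat.log 2 n + 2) := by
    have := Nat.lt_pow_succ_log_self Nat.one_lt_two n
    rw [pow_succ]; omega
  set L : ℕ := Nat.log 2 n with hL
  set c' : ℕ := c₁ * c + 2 * c + 2 with hc'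
  have hexp : (L + 2) * ((c₁ + 2) * c) ≤ (L + c') ^ c' := by
    have hB1 : 1 ≤ L + c' := by omega
    have hle1 : L + 2 ≤ L + c' := by omega
    have hmul : (c₁ + 2) * c = c₁ * c + 2 * c := by ring
    have hle2 : (c₁ + 2) * c ≤ L + c' := by rw [hmul]; omega
    calc (L + 2) * ((c₁ + 2) * c) ≤ (L + c') * (L + c') := Nat.mul_le_mul hle1 hle2
      _ = (L + c') ^ 2 := by ring
      _ ≤ (L + c') ^ c' := Nat.pow_le_pow_right hB1 (by omega)
  calc (C.size + n + 2) ^ c ≤ ((n + 2) ^ (c₁ + 2)) ^ c := Nat.pow_le_pow_left h1 _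
    _ = (n + 2) ^ ((c₁ + 2) * c) := by rw [← pow_mul]
    _ ≤ (2 ^ (L + 2)) ^ ((c₁ + 2) * c) := Nat.pow_le_pow_left hlog _
    _ = 2 ^ ((L + 2) * ((c₁ + 2) * c)) := by rw [← pow_mul]
    _ ≤ 2 ^ ((L + c') ^ c') := Nat.pow_le_pow_right (by norm_num) hexp

end Summit.ValiantsHypothesis.ValiantsHypothesis.Theorems
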